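import Summits.QuantumFields.YangMills.Theorems.BalabanUVNodesN12DirectChartLetterCore
import HarnessLib

/-!
# BalabanUVNodes ∕ N12 — THE CURRENT FACTOR FROM PLAQUETTE SMALLNESS OVER A DISPLAYED SUPPORT SET `S₀` ([Balaban1985BackgroundPropagators] (3.7) p.391; [Balaban1989LargeFieldI] (8) p.279;
# [Balaban1989LargeFieldII] (1.12) p.359)

Cell `pub-ymgap` (HUMAN RULINGS D-0062 ∕ D-0149), seat `pub-ymgap-dag-n12-d` g32 (R134 N12 [B15] s2; the (ii) Theorems-side re-key of N12's road at print's [II] (2.3) datum — director-ym №338 ∕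
№343 (E1)(iii-b); dag-n12-c RE-KEY NOTE I.18590, the `S`-device of `B15Prop1EndpointNearFlatLettersWindowB`).  Count-neutral helper of K1⁹ `stmt-QuantumFields-27364`,
`--kind proof --supports … --as helper`.  THEOREMS ONLY (0 `def`, 0 `instance`, 0 `sorry`).

WHAT.  `…N12DirectChartLetterCore.abs_fderiv_wilsonAction4_expChart_apply_le_of_plaqSmall` (dag-n12-w4's plaquette-budget first variation, ✓p610492's §1) hard-wires the support set
`{b | b₋ ∈ Ω₁(Z)}` of reading (b).  At print's [II] (2.3) datum the level-0 constrained bonds are those with BOTH end-points off `Ω₁(Z)`, so the velocity of the (K′) family is supported on the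
bonds TOUCHING `Ω₁(Z)` (`{b | b₋ ∈ Ω₁ ∨ b₊ ∈ Ω₁}`) — a different set.  THIS FILE states the lemma over an ARBITRARY support set `S₀ : Set (PBond (F.P Kt) 0)`: if `Y` vanishes off `S₀` and
`‖↑U₀(∂p) − 1‖ ≤ εP` on every plaquette meeting `S₀`, then `|D(A∘expChart U₀)(0)Y| ≤ 2(d−1)·εP·Σ_b‖↑Y_b‖`.  Proof verbatim from the parent lemma (budget `εP` on the plaquettes meeting `S₀`,
`2` elsewhere — `Node00.abs_deriv_wilsonAction4_expChart_zero_le_local`; incidence count `Node00.sum_plaq_boundary_eq`).  Consumed by `…N12DirectChartPackageOfClassRowL1B`.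
§2 `l2Seminorm_le_of_bound_of_suppSet`: the ℓ²-size of a field supported on a displayed BOND set (`p(Y) ≤ √#S·a`) — the bond-set edition of
`…NearFlatChartLetterBookkeeping.l2Seminorm_le_of_bound_of_support` (site support `{b | b₋ ∈ S}`); consumed by L1ᴮ's ℓ² velocity letter.

HONEST FRAMING.  Bookkeeping on the tree's own Wilson action; nothing of Bałaban's estimates asserted; N12 NOT discharged; K0⁷ ∕ K1⁹ NOT closed; counts unmoved (typed 28∕28 · discharged 8∕27,
A 8∕28; K 1∕4); one finite 𝕋⁴ programme at fixed ε — R4 closes the conditional rung `BalabanLadder.UV` only; NOT the Yang–Mills mass gap (Clay); nothing continuum ∕ ℝ⁴ ∕ OS.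
-/

noncomputable section

open scoped BigOperators Matrix.Norms.L2Operator Topology
open Filter Finset

namespace Summit.QuantumFields.YangMills.BalabanUVNodes.N12DirectChartCurrentOfSupport

open Literature.MathematicalPhysics.QuantumFieldTheory.Balaban1983to89
open T4Continuum (T4Family)
open T4AdjointCovarianceUnitary (lieSU)
open T4CubeChartGnomonic (SU2)
open B15DeterminingSets GaugeField
open Node00
open B16Ineq17NearFlatWilsonLetters (fderiv_wilsonAction4_expChart_apply_eq_deriv)

variable {F : T4Family} {Kt : ℕ}

/-- ★ **THE CURRENT FACTOR FROM PLAQUETTE SMALLNESS, OVER A DISPLAYED SUPPORT SET `S₀`** — `…N12DirectChartLetterCore.abs_fderiv_wilsonAction4_expChart_apply_le_of_plaqSmall` with the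
hard-wired support `{b | b₋ ∈ Ω₁(Z)}` (reading (b)) replaced by an ARBITRARY set `S₀` of fine bonds (dag-n12-c's `S`-device, RE-KEY NOTE: at print's [II] (2.3) datum the velocity of the
(K′) family is supported on the bonds TOUCHING `Ω₁(Z)`): if `Y` vanishes off `S₀` and `‖↑U₀(∂p) − 1‖ ≤ εP` on every plaquette meeting `S₀`, then `|D(A∘expChart U₀)(0)Y| ≤ 2(d−1)·εP·Σ_b‖↑Y_b‖`.
Proof verbatim from the parent lemma (dag-n12-w4 g2's plaquette-budget first variation `Node00.abs_deriv_wilsonAction4_expChart_zero_le_local` with budget `εP` on the plaquettes meeting `S₀`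
and `2` elsewhere; the incidence count `Node00.sum_plaq_boundary_eq`). [cite: Balaban1985BackgroundPropagators, (3.7) p.391; Balaban1989LargeFieldI, (8) p.279; Balaban1989LargeFieldII, (1.12) p.359] -/
theorem abs_fderiv_wilsonAction4_expChart_apply_le_of_plaqSmall_supp (S₀ : Set (PBond (F.P Kt) 0))
    (U₀ : GaugeField (F.P Kt) 0 SU2) {εP : ℝ}
    (hP : ∀ p : Plaq (F.P Kt) 0, ((⟨p.src, p.μ⟩ : PBond (F.P Kt) 0) ∈ S₀ ∨ (⟨p.src.shift p.μ, p.ν⟩ : PBond (F.P Kt) 0) ∈ S₀ ∨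
          (⟨p.src.shift p.ν, p.μ⟩ : PBond (F.P Kt) 0) ∈ S₀ ∨ (⟨p.src, p.ν⟩ : PBond (F.P Kt) 0) ∈ S₀) →
      ‖((GaugeField.plaqHol U₀ p : SU2) : Matrix (Fin 2) (Fin 2) ℂ) - 1‖ ≤ εP)
    (Y : PBond (F.P Kt) 0 → lieSU (Fin 2)) (hY : ∀ b ∉ S₀, Y b = 0) :
    |fderiv ℝ (fun X : PBond (F.P Kt) 0 → lieSU (Fin 2) => wilsonAction4 (expChart U₀ X)) 0 Y|
      ≤ 2 * (((F.P Kt).d : ℝ) - 1) * εP * ∑ b : PBond (F.P Kt) 0, ‖(Y b : Matrix (Fin 2) (Fin 2) ℂ)‖ := by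
  classical
  rw [fderiv_wilsonAction4_expChart_apply_eq_deriv]
  let bud : Plaq (F.P Kt) 0 → ℝ := fun p => if ((⟨p.src, p.μ⟩ : PBond (F.P Kt) 0) ∈ S₀ ∨ (⟨p.src.shift p.μ, p.ν⟩ : PBond (F.P Kt) 0) ∈ S₀ ∨
          (⟨p.src.shift p.ν, p.μ⟩ : PBond (F.P Kt) 0) ∈ S₀ ∨ (⟨p.src, p.ν⟩ : PBond (F.P Kt) 0) ∈ S₀) then εP else 2
  have hbud : ∀ p : Plaq (F.P Kt) 0, ‖((GaugeField.plaqHol U₀ p : SU2) : Matrix (Fin 2) (Fin 2) ℂ) - 1‖ ≤ bud p := by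
    intro p
    by_cases h : ((⟨p.src, p.μ⟩ : PBond (F.P Kt) 0) ∈ S₀ ∨ (⟨p.src.shift p.μ, p.ν⟩ : PBond (F.P Kt) 0) ∈ S₀ ∨
          (⟨p.src.shift p.ν, p.μ⟩ : PBond (F.P Kt) 0) ∈ S₀ ∨ (⟨p.src, p.ν⟩ : PBond (F.P Kt) 0) ∈ S₀)
    · have hb : bud p = εP := if_pos h
      rw [hb]; exact hP p h
    · have hb : bud p = 2 := if_neg h
      rw [hb]; exact norm_coe_plaqHol_sub_one_le_two U₀ p
  have hmain := abs_deriv_wilsonAction4_expChart_zero_le_local U₀ Y bud hbud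
  have hterm : ∀ p : Plaq (F.P Kt) 0, bud p * (‖(Y ⟨p.src, p.μ⟩ : Matrix (Fin 2) (Fin 2) ℂ)‖ + ‖(Y ⟨p.src.shift p.μ, p.ν⟩ : Matrix (Fin 2) (Fin 2) ℂ)‖
        + ‖(Y ⟨p.src.shift p.ν, p.μ⟩ : Matrix (Fin 2) (Fin 2) ℂ)‖ + ‖(Y ⟨p.src, p.ν⟩ : Matrix (Fin 2) (Fin 2) ℂ)‖)
      ≤ εP * (‖(Y ⟨p.src, p.μ⟩ : Matrix (Fin 2) (Fin 2) ℂ)‖ + ‖(Y ⟨p.src.shift p.μ, p.ν⟩ : Matrix (Fin 2) (Fin 2) ℂ)‖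
        + ‖(Y ⟨p.src.shift p.ν, p.μ⟩ : Matrix (Fin 2) (Fin 2) ℂ)‖ + ‖(Y ⟨p.src, p.ν⟩ : Matrix (Fin 2) (Fin 2) ℂ)‖) := by
    intro p
    by_cases h : ((⟨p.src, p.μ⟩ : PBond (F.P Kt) 0) ∈ S₀ ∨ (⟨p.src.shift p.μ, p.ν⟩ : PBond (F.P Kt) 0) ∈ S₀ ∨
          (⟨p.src.shift p.ν, p.μ⟩ : PBond (F.P Kt) 0) ∈ S₀ ∨ (⟨p.src, p.ν⟩ : PBond (F.P Kt) 0) ∈ S₀)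
    · have hb : bud p = εP := if_pos h
      rw [hb]
    · simp only [not_or] at h
      obtain ⟨h1, h2, h3, h4⟩ := h
      rw [hY _ h1, hY _ h2, hY _ h3, hY _ h4]
      simp
  have hd : 0 ≤ ((F.P Kt).d : ℝ) - 1 := by
    have h1 : (1 : ℝ) ≤ (F.P Kt).d := by exact_mod_cast (F.P Kt).hd
    linarith
  calc |deriv (fun s : ℝ => wilsonAction4 (expChart U₀ (s • Y))) 0|
      ≤ ∑ p : Plaq (F.P Kt) 0, bud p * (‖(Y ⟨p.src, p.μ⟩ : Matrix (Fin 2) (Fin 2) ℂ)‖ + ‖(Y ⟨p.src.shift p.μ, p.ν⟩ : Matrix (Fin 2) (Fin 2) ℂ)‖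
        + ‖(Y ⟨p.src.shift p.ν, p.μ⟩ : Matrix (Fin 2) (Fin 2) ℂ)‖ + ‖(Y ⟨p.src, p.ν⟩ : Matrix (Fin 2) (Fin 2) ℂ)‖) := hmain
    _ ≤ ∑ p : Plaq (F.P Kt) 0, εP * (‖(Y ⟨p.src, p.μ⟩ : Matrix (Fin 2) (Fin 2) ℂ)‖ + ‖(Y ⟨p.src.shift p.μ, p.ν⟩ : Matrix (Fin 2) (Fin 2) ℂ)‖
        + ‖(Y ⟨p.src.shift p.ν, p.μ⟩ : Matrix (Fin 2) (Fin 2) ℂ)‖ + ‖(Y ⟨p.src, p.ν⟩ : Matrix (Fin 2) (Fin 2) ℂ)‖) := Finset.sum_le_sum fun p _ => hterm p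
    _ = εP * (2 * (((F.P Kt).d : ℝ) - 1) * ∑ b : PBond (F.P Kt) 0, ‖(Y b : Matrix (Fin 2) (Fin 2) ℂ)‖) := by
        rw [← Finset.mul_sum, sum_plaq_boundary_eq (fun b : PBond (F.P Kt) 0 => ‖(Y b : Matrix (Fin 2) (Fin 2) ℂ)‖)]
    _ = 2 * (((F.P Kt).d : ℝ) - 1) * εP * ∑ b : PBond (F.P Kt) 0, ‖(Y b : Matrix (Fin 2) (Fin 2) ℂ)‖ := by ring

section SupportSetL2

open Summit.QuantumFields.YangMills.BalabanUVNodes.N12NearFlatChartLetter (l2Seminorm_apply)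

variable {P : Params} {j N : ℕ}

/-- **ℓ²-size of a field supported on a displayed BOND set**: if `‖Y b‖ ≤ a` everywhere and `Y` vanishes off `S`, then `p(Y) ≤ √#S · a` (`p` = the bond-ℓ² seminorm) — the bond-set
edition of `…N12NearFlatChartLetterBookkeeping.l2Seminorm_le_of_bound_of_support` (there: the site-support `{b | b₋ ∈ S}` of reading (b); at print's [II] (2.3) datum the velocity of the
(K′) family is supported on the bonds TOUCHING `Ω₁(Z)`, dag-n12-c RE-KEY NOTE). [cite: Balaban1989LargeFieldII, (1.12)–(1.13) p.359 (bookkeeping)] -/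
theorem l2Seminorm_le_of_bound_of_suppSet (S : Set (PBond P j)) (Y : PBond P j → lieSU (Fin N)) {a : ℝ} (ha : 0 ≤ a)
    (hb : ∀ b, ‖Y b‖ ≤ a) (hs : ∀ b ∉ S, Y b = 0) :
    (normSeminorm ℝ (PiLp 2 (fun _ : PBond P j => lieSU (Fin N)))).comp (WithLp.linearEquiv 2 ℝ (PBond P j → lieSU (Fin N))).symm.toLinearMap Y
      ≤ Real.sqrt (Nat.card {b : PBond P j // b ∈ S}) * a := by
  classical
  rw [l2Seminorm_apply, ← Real.sqrt_sq ha, ← Real.sqrt_mul (Nat.cast_nonneg _)]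
  refine Real.sqrt_le_sqrt ?_
  have hsplit : ∑ b, ‖Y b‖ ^ 2 = ∑ b ∈ Finset.univ.filter (fun b : PBond P j => b ∈ S), ‖Y b‖ ^ 2 := by
    rw [Finset.sum_filter]
    refine Finset.sum_congr rfl fun b _ => ?_
    split_ifs with h
    · rfl
    · rw [hs b h, norm_zero]; simp
  rw [hsplit]
  have hcard : ((Finset.univ.filter (fun b : PBond P j => b ∈ S)).card : ℝ) = (Nat.card {b : PBond P j // b ∈ S} : ℝ) := by
    rw [Nat.card_eq_fintype_card, Fintype.card_subtype]
  calc ∑ b ∈ Finset.univ.filter (fun b : PBond P j => b ∈ S), ‖Y b‖ ^ 2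
      ≤ ∑ _b ∈ Finset.univ.filter (fun b : PBond P j => b ∈ S), a ^ 2 :=
        Finset.sum_le_sum fun b _ => pow_le_pow_left₀ (norm_nonneg _) (hb b) 2
    _ = (Nat.card {b : PBond P j // b ∈ S} : ℝ) * a ^ 2 := by rw [Finset.sum_const, nsmul_eq_mul, hcard]

end SupportSetL2

end Summit.QuantumFields.YangMills.BalabanUVNodes.N12DirectChartCurrentOfSupport

end
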